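import Mathlib
import HarnessLib
import Literature.NumberTheory.LFunctions.ZetaScrew
import Summits.RiemannHypothesis.RiemannHypothesis.Theorems.IntegerScrewContinuumFloor
import Summits.RiemannHypothesis.RiemannHypothesis.Theorems.IntegerScrewArithmeticFloor

/-!
# Route `IntegerScrew` — the arithmetic floor in SERIES form:
# `liminf_{S_{M−1} ≻ 0} G(M)·log M ≥ V/2 + H₂ = Σ_k (c_k/2)² + Σ_n Λ(n)²/n²`
# (PIVOT-LAW §15.14/§15.16; RH-FREE given `S_{M−1} ≻ 0`)

`IntegerScrewArithmeticFloor.eventually_arithmetic_deficit_floor` bounds `G(M)·log M` below by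
`S_K + Σ_{n ∈ P} Λ(n)²/n² − ε` for every `K` and every finite `P`.  Both series converge
(`IntegerScrewContinuumFloor.summable_pivotLagCoeff_sq`: `(c_k/2)² ≤ 9/(4k²)`; here
`summable_vonMangoldt_sq_div_sq`: `Λ(n)²/n² ≤ 16/n^{3/2}` from `Λ(n) ≤ log n ≤ 4n^{1/4}`), so:

* `eventually_arithmetic_deficit_floor_series` : for every `δ > 0`, eventually in `M`,
  `S_{M−1} ≻ 0 → (Σ'_k (c_k/2)²) + (Σ'_n Λ(n)²/n²) − δ ≤ G(M)·log M` — i.e.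
  `liminf G·log M ≥ V/2 + H₂ = 0.6493591 + 0.80521 = 1.45457` (PIVOT-LAW §15.14);
* `eventually_arithmetic_deficit_floor_series_of_riemannHypothesis` : the same under RH, for all `M`.

Lower bounds on the deficit point away from RH; nothing here bears on the truth of RH. [Suzuki2023, (1.1), (1.4)]
-/

noncomputable section

-- D-0017: `Summit.<S>.<S>.…` is the designed namespace of a single-problem summit.
set_option linter.dupNamespace false

namespace Summit.RiemannHypothesis.RiemannHypothesis.Theorems.IntegerScrew

open Literature.NumberTheory.LFunctions Filter Finset
open scoped Topology

/-- `Σ_n Λ(n)²/n²` converges (`Λ(n)² ≤ log²n ≤ 16√n`, so the terms are `≤ 16/n^{3/2}`). [folklore] -/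
theorem summable_vonMangoldt_sq_div_sq :
    Summable fun n : ℕ => (ArithmeticFunction.vonMangoldt n) ^ 2 / (n : ℝ) ^ 2 := by
  have hcmp : Summable fun n : ℕ => (16 : ℝ) * (1 / (n : ℝ) ^ (3 / 2 : ℝ)) :=
    (Real.summable_one_div_nat_rpow.mpr (by norm_num)).mul_left 16
  refine Summable.of_nonneg_of_le (fun n => by positivity) (fun n => ?_) hcmp
  rcases Nat.eq_zero_or_pos n with h0 | hpos
  · subst h0; simp
  have hn : (0 : ℝ) < n := by exact_mod_cast hpos
  have hΛ0 : 0 ≤ ArithmeticFunction.vonMangoldt n := ArithmeticFunction.vonMangoldt_nonneg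
  have hΛ : ArithmeticFunction.vonMangoldt n ≤ Real.log n := ArithmeticFunction.vonMangoldt_le_log
  have hlog : Real.log n ≤ (n : ℝ) ^ (1 / 4 : ℝ) / (1 / 4) := Real.log_le_rpow_div hn.le (by norm_num)
  have hq0 : 0 ≤ (n : ℝ) ^ (1 / 4 : ℝ) := by positivity
  have hΛ4 : ArithmeticFunction.vonMangoldt n ≤ 4 * (n : ℝ) ^ (1 / 4 : ℝ) := by linarith
  have hsq : (ArithmeticFunction.vonMangoldt n) ^ 2 ≤ 16 * (n : ℝ) ^ (1 / 2 : ℝ) := by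
    have h1 : (ArithmeticFunction.vonMangoldt n) ^ 2 ≤ (4 * (n : ℝ) ^ (1 / 4 : ℝ)) ^ 2 :=
      pow_le_pow_left₀ hΛ0 hΛ4 2
    have h2 : (4 * (n : ℝ) ^ (1 / 4 : ℝ)) ^ 2 = 16 * (n : ℝ) ^ (1 / 2 : ℝ) := by
      rw [mul_pow, ← Real.rpow_natCast ((n : ℝ) ^ (1 / 4 : ℝ)) 2, ← Real.rpow_mul hn.le]
      norm_num
    rw [h2] at h1; exact h1
  -- 16·n^{1/2}/n² = 16/n^{3/2}
  have hn2 : (n : ℝ) ^ 2 = (n : ℝ) ^ (1 / 2 : ℝ) * (n : ℝ) ^ (3 / 2 : ℝ) := by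
    rw [← Real.rpow_add hn, ← Real.rpow_natCast (n : ℝ) 2]; norm_num
  rw [div_le_iff₀ (by positivity), hn2]
  have h32 : 0 < (n : ℝ) ^ (3 / 2 : ℝ) := by positivity
  have e : 16 * (1 / (n : ℝ) ^ (3 / 2 : ℝ)) * ((n : ℝ) ^ (1 / 2 : ℝ) * (n : ℝ) ^ (3 / 2 : ℝ))
      = 16 * (n : ℝ) ^ (1 / 2 : ℝ) := by
    field_simp
  rw [e]; exact hsq

/-- `Σ'_n Λ(n)²/n²` along `range`: the partial sums over `{n < Q+1 : 2 ≤ n}` are the partial sums over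
`range (Q+1)` (the terms `n = 0, 1` vanish). [folklore] -/
private theorem sum_filter_two_le_eq (Q : ℕ) :
    ∑ n ∈ (Finset.range (Q + 1)).filter (fun n => 2 ≤ n),
        (ArithmeticFunction.vonMangoldt n) ^ 2 / (n : ℝ) ^ 2
      = ∑ n ∈ Finset.range (Q + 1), (ArithmeticFunction.vonMangoldt n) ^ 2 / (n : ℝ) ^ 2 := by
  rw [Finset.sum_filter]
  refine Finset.sum_congr rfl fun n _ => ?_
  split_ifs with h
  · rfl
  · interval_cases n <;> simp [ArithmeticFunction.vonMangoldt_apply_one]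

/-- **THE ARITHMETIC FLOOR IN SERIES FORM** (PIVOT-LAW §15.14): for every `δ > 0`, eventually in `M`,
`S_{M−1} ≻ 0 → Σ'_k (c_k/2)² + Σ'_n Λ(n)²/n² − δ ≤ M·(2Ψ(log(M/(M−1))) − d_M)·log M`, i.e.
`liminf_{S_{M−1}≻0} G(M)·log M ≥ V/2 + H₂` (`V/2 = ¼Σ(Δ²[k log k])² = 0.6493591`, `H₂ = Σ_q Λ(q)²/q² = 0.80521`).
[folklore] -/
theorem eventually_arithmetic_deficit_floor_series (δ : ℝ) (hδ : 0 < δ) :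
    ∀ᶠ M : ℕ in atTop, (screwMatrix (M - 2)).PosDef →
      (∑' k : ℕ, (-(((k : ℝ) + 1) * Real.log ((k : ℝ) + 1) - 2 * ((k : ℝ) * Real.log k)
          + ((k : ℝ) - 1) * Real.log ((k : ℝ) - 1)) / 2) ^ 2)
        + (∑' n : ℕ, (ArithmeticFunction.vonMangoldt n) ^ 2 / (n : ℝ) ^ 2) - δ ≤
        (M : ℝ) * (2 * zetaScrew (Real.log ((M : ℝ) / ((M : ℝ) - 1))) - screwPivot M)
          * Real.log (M : ℝ) := by
  set f : ℕ → ℝ := fun k => (-(((k : ℝ) + 1) * Real.log ((k : ℝ) + 1) - 2 * ((k : ℝ) * Real.log k)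
      + ((k : ℝ) - 1) * Real.log ((k : ℝ) - 1)) / 2) ^ 2 with hf
  set g : ℕ → ℝ := fun n => (ArithmeticFunction.vonMangoldt n) ^ 2 / (n : ℝ) ^ 2 with hg
  have hfsum : Summable f := summable_pivotLagCoeff_sq
  have hgsum : Summable g := summable_vonMangoldt_sq_div_sq
  have hδ3 : 0 < δ / 3 := by linarith
  -- the lag series: K with Σ_{k ≤ K} f ≥ tsum − δ/3
  have hf0 : f 0 = 0 := by simp [hf, Real.log_one]
  obtain ⟨N, hN⟩ := eventually_atTop.1
    (hfsum.hasSum.tendsto_sum_nat.eventually (lt_mem_nhds (sub_lt_self (∑' k, f k) hδ3)))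
  have hK := hN (N + 1) (by omega)
  have hsplitf : ∑ k ∈ range (N + 1), f k = ∑ k ∈ Icc 1 N, f k := by
    rw [Finset.sum_range_succ', hf0, add_zero,
      show Finset.Icc 1 N = Finset.Ico 1 (N + 1) from rfl, Finset.sum_Ico_eq_sum_range,
      Nat.add_sub_cancel]
    exact Finset.sum_congr rfl fun k _ => by rw [add_comm]
  rw [hsplitf] at hK
  -- the hinge series: Q with Σ_{n ≤ Q} g ≥ tsum − δ/3
  obtain ⟨Q', hQ'⟩ := eventually_atTop.1
    (hgsum.hasSum.tendsto_sum_nat.eventually (lt_mem_nhds (sub_lt_self (∑' n, g n) hδ3)))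
  have hQ := hQ' (Q' + 1) (by omega)
  set P : Finset ℕ := (Finset.range (Q' + 1)).filter (fun n => 2 ≤ n) with hPdef
  have hP : ∀ n ∈ P, 2 ≤ n := fun n hn => (Finset.mem_filter.1 hn).2
  have hsplitg : ∑ n ∈ P, g n = ∑ n ∈ range (Q' + 1), g n := by
    simp only [hg, hPdef]
    exact sum_filter_two_le_eq Q'
  rw [← hsplitg] at hQ
  -- the finite floor with ε = δ/3
  filter_upwards [eventually_arithmetic_deficit_floor N P hP (δ / 3) hδ3] with M hM hPD
  have h := hM hPD
  simp only [hf, hg] at hK hQ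
  linarith

/-- Under RH: for every `δ > 0`, eventually `V/2 + H₂ − δ ≤ G(M)·log M` through all `M`. [folklore] -/
theorem eventually_arithmetic_deficit_floor_series_of_riemannHypothesis (hRH : _root_.RiemannHypothesis)
    (δ : ℝ) (hδ : 0 < δ) :
    ∀ᶠ M : ℕ in atTop,
      (∑' k : ℕ, (-(((k : ℝ) + 1) * Real.log ((k : ℝ) + 1) - 2 * ((k : ℝ) * Real.log k)
          + ((k : ℝ) - 1) * Real.log ((k : ℝ) - 1)) / 2) ^ 2)
        + (∑' n : ℕ, (ArithmeticFunction.vonMangoldt n) ^ 2 / (n : ℝ) ^ 2) - δ ≤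
        (M : ℝ) * (2 * zetaScrew (Real.log ((M : ℝ) / ((M : ℝ) - 1))) - screwPivot M)
          * Real.log (M : ℝ) :=
  (eventually_arithmetic_deficit_floor_series δ hδ).mono fun M hM =>
    hM (screwMatrix_posDef_of_riemannHypothesis hRH (M - 2))

end Summit.RiemannHypothesis.RiemannHypothesis.Theorems.IntegerScrew

end
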